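import Literature.Analysis.FluidPDE.SereginZajaczkowski2007Lemma23Assembly
import Literature.Analysis.FluidPDE.SereginEpsilonRegularityGradientOfBounds
import Literature.Analysis.FluidPDE.PressureDecayEstimateProofs
import Literature.Analysis.FluidPDE.SereginSverakOffAxisLeaves
import HarnessLib

/-!
# Seregin–Zajaczkowski 2007, Lemma 2.3 and Proposition 4.1: the discharge frontier, assembled

Proofs-only glue file (no definitions, no named facts) for the named facts
`SereginZajaczkowski2007.L6EpsilonRegularity` (Lemma 2.3) and `SereginZajaczkowski2007.OffAxisSupBound`
(Prop. 4.1) of `SereginZajaczkowski2007.lean` (G. Seregin, W. Zajaczkowski, *A sufficient condition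
of regularity for axially symmetric solutions to the Navier–Stokes equations*, SIAM J. Math. Anal.
39 (2007) 669–685 = arXiv:math/0702720; numbers are those of the arXiv version).

The printed proof of Lemma 2.3 (arXiv p. 3: the decay estimate for the pressure (2.2) "[S2]"
iterated along `r = τ^k/4`, Hölder's inequality from the `L₆` bound (2.6), and "according to the
so-called ε-regularity theory, see, for example, [LS], [ESS4], and [S8], the latter implies two
bounds: `|v(z₀)| ≤ c/r₀` and `|∇v(z₀)| ≤ c/r₀²`") is formalised in the tree as the accepted
reduction `l6EpsilonRegularity_of : seregin_sverak_pressure_decay →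
lemarieRieusset_epsilon_regularity → seregin2014_lemma61_gradient → L6EpsilonRegularity`
(`SereginZajaczkowski2007Lemma23Tools.lean`, `SereginZajaczkowski2007Lemma23.lean`,
`SereginZajaczkowski2007Lemma23Assembly.lean`). Of its three inputs,

* (2.2) is a theorem (`seregin_sverak_pressure_decay_holds`, `PressureDecayEstimateProofs.lean`);
* the velocity half of the ε-regularity theory is a theorem
  (`lemarieRieusset_epsilon_regularity_holds`, `CKNEpsilonRegularityHolds.lean`);
* the gradient half, Seregin 2014, Ch. 6, Lemma 6.1, case `k = 2` (= [ESS4], Lemma 2.2)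
  (`seregin2014_lemma61_gradient`), is reduced by the accepted
  `seregin2014_lemma61_gradient_of_higherRegularityBounds`
  (`SereginEpsilonRegularityGradientOfBounds.lean`) to the quantitative higher interior regularity
  of bounded solutions `NSBoundedHigherRegularityBounds` (`NSBoundedHigherRegularityQuant.lean`;
  Seregin–Šverák 2009, §2 p. 8 = Seregin 2014, §6.3: "for any natural `k`, `∇ᵏv` is Hölder
  continuous in `Q̄₂` … norms estimated by constants depending on the data").

This file composes these pieces and records the exact remaining trust base as checked terms:

* `l6EpsilonRegularity_of_higherRegularityBounds : NSBoundedHigherRegularityBounds →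
  L6EpsilonRegularity` — Lemma 2.3 rests on that SINGLE shared named fact, so that
  `L6EpsilonRegularity_holds` is the term `l6EpsilonRegularity_of_higherRegularityBounds
  NSBoundedHigherRegularityBounds_holds` once that discharge exists;
* `offAxisSupBound_of_l6Bound_of_higherRegularityBounds : OffAxisL6Bound →
  NSBoundedHigherRegularityBounds → OffAxisSupBound` — Prop. 4.1 ("Applying Corollary 4.4 and
  Lemma 2.3", §4 p. 7, the accepted `offAxisSupBound_of`) from Cor. 4.4 and the leaf;
* `offAxisSupBound_of_leaves : SwirlL4EnergyBound → NSBoundedHigherRegularityBounds →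
  OffAxisSupBound` — with Cor. 4.4 (`OffAxisL6Bound`) reduced to the `L⁴`-energy bound (4.18)
  for the cut-off swirl by the accepted `offAxisL6Bound_of_swirlL4EnergyBound`
  (`SereginSverakOffAxisLeaves.lean`: Lemma 4.2 proved, Lemma 4.3 from (4.18)), Prop. 4.1 rests on
  the TWO named facts `SereginZajaczkowski2007.SwirlL4EnergyBound` and
  `NSBoundedHigherRegularityBounds`, the same frontier as Seregin–Šverák 2009, Prop. 3.7
  (`SereginSverak2009.axisDecayBound_of_leaves_of_bounds`).

Nothing new is asserted.

## References

* G. Seregin, W. Zajaczkowski, SIAM J. Math. Anal. 39 (2007) 669–685, arXiv:math/0702720: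
  Lemma 2.3 and its proof (p. 3), Prop. 4.1, Cor. 4.4 and the proof of Prop. 4.1 (§4, p. 7).
  [`SereginZajaczkowski2007`]
* G. Seregin, *Lecture Notes on Regularity Theory for the Navier–Stokes Equations*, World
  Scientific 2014, Ch. 6: Lemma 6.1 and Remark 6.1 (PDF p. 90); §6.3 (PDF p. 111). [`Seregin2014`]
* G. Seregin, V. Šverák, Comm. PDE 34 (2009) 171–201 = arXiv:0804.1803, §2 p. 8.
  [`SereginSverak2009`]
-/

noncomputable section

namespace Literature.Analysis.FluidPDE

namespace SereginZajaczkowski2007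

/-- **Seregin–Zajaczkowski 2007, Lemma 2.3 (`L6EpsilonRegularity`) from the single remaining
leaf**: the accepted reduction `l6EpsilonRegularity_of` fed with the theorems
`seregin_sverak_pressure_decay_holds` ((2.2), "[S2]") and `lemarieRieusset_epsilon_regularity_holds`
(the velocity half of the ε-regularity theory) and with the gradient half
`seregin2014_lemma61_gradient` obtained from the quantitative higher interior regularity of
bounded solutions by the accepted `seregin2014_lemma61_gradient_of_higherRegularityBounds`.
[cite: SereginZajaczkowski2007, Lemma 2.3 and its proof (arXiv p. 3)] -/
theorem l6EpsilonRegularity_of_higherRegularityBounds (hB : NSBoundedHigherRegularityBounds) :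
    L6EpsilonRegularity :=
  l6EpsilonRegularity_of seregin_sverak_pressure_decay_holds
    lemarieRieusset_epsilon_regularity_holds
    (seregin2014_lemma61_gradient_of_higherRegularityBounds hB)

/-- **Seregin–Zajaczkowski 2007, Proposition 4.1 (`OffAxisSupBound`) from Corollary 4.4 and the
remaining leaf of Lemma 2.3** ("Applying Corollary 4.4 and Lemma 2.3, we end up with the proof of
Proposition 4.1", §4 p. 7): the accepted `offAxisSupBound_of` composed with
`l6EpsilonRegularity_of_higherRegularityBounds`.
[cite: SereginZajaczkowski2007, proof of Prop. 4.1 (§4, last paragraph, arXiv p. 7)] -/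
theorem offAxisSupBound_of_l6Bound_of_higherRegularityBounds (h44 : OffAxisL6Bound)
    (hB : NSBoundedHigherRegularityBounds) : OffAxisSupBound :=
  offAxisSupBound_of h44 (l6EpsilonRegularity_of_higherRegularityBounds hB)

/-- **Seregin–Zajaczkowski 2007, Proposition 4.1 from the two remaining leaves**: the `L⁴`-energy
bound (4.18) for the cut-off swirl (`SwirlL4EnergyBound`, giving Cor. 4.4 by the accepted
`offAxisL6Bound_of_swirlL4EnergyBound`, Lemma 4.2 being proved) and the quantitative higher
interior regularity of bounded solutions (`NSBoundedHigherRegularityBounds`, giving Lemma 2.3 by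
`l6EpsilonRegularity_of_higherRegularityBounds`). The unconditional `OffAxisSupBound_holds` is
this theorem applied to `SwirlL4EnergyBound_holds` and `NSBoundedHigherRegularityBounds_holds`
once they exist. [cite: SereginZajaczkowski2007, Prop. 4.1 ((4.1)) and its proof (§4, arXiv p. 7)] -/
theorem offAxisSupBound_of_leaves (h418 : SwirlL4EnergyBound)
    (hB : NSBoundedHigherRegularityBounds) : OffAxisSupBound :=
  offAxisSupBound_of_l6Bound_of_higherRegularityBounds (offAxisL6Bound_of_swirlL4EnergyBound h418) hB

end SereginZajaczkowski2007

end Literature.Analysis.FluidPDE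

end
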